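import Mathlib
import HarnessLib
import Summits.HubbardSuperconductivity.HubbardSuperconductivity.Theorems.KLProgrammeH10TwoPointLimitKlAnisoFiveAnchoredSectorCount
import Summits.HubbardSuperconductivity.HubbardSuperconductivity.Theorems.KLProgrammeKLRegimeEngineTowerImportP2Floor

/-!
# K3 ENGINE child `KLRegimeEngineV17F2` (stmt-HubbardSuperconductivity-20437), stub (b) import `X` (six legs, one level): the ONE-ANCHOR six-leg sector count
# `≤ C·|SectorLeg|⁴` from the five-anchored count, NAMED DOORS `klThinCount6C`, `klThinCount6C₃ R`, `klThinCount6U₀ R`, and the SIX-LEG ONE-LEVEL FLOOR IMPORT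

Cell gate-hubbard-kl, seat hubbard-kl-k3c2-p3 (g14), row «sector-counting import», located «(ℓ)-IMPORT-X-FLOOR» (KL STATUS 2026-08-29).  WHY.  The floor-keyed law
(`klTowerBLevF_le_law_lev_of_blocks[_Z|_ZX]`) imports, per block `k`, the six-leg one-level floor array `klTowerMuLevAtF … d 0 k 3 ≤ X′·λ²` (track `t = 0`: the marginal
exponent `e_F = 0`), and RO-5's closer the same cell at the read-out level; in the kit's vocabulary this is the sectorised six-leg norm of the block input `𝒱_{dk}` at
`F_{dk−1}` with ONE leg prescribed, divided by the floor unit `klLevUnitF β M 0 3 J = ε⁵·2^{4J}`.  BGM (2.76)–(2.77): `‖W₆‖ ≤ (one-anchor count) × (all-fixed pinned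
line)`, and the one-anchor count of six-leg label tuples is `≤ C·(4·sectorCount J)⁴ = C·4096·2^{4J}` — four free legs summed, the sixth determined by the
five-anchored count (…KlAnisoFiveAnchoredSectorCount) — so the `2^{4J}` cancels against the unit: the import is k-UNIFORM.

* §1 `card_filter_eq_le_of_fiveAnchored` (combinatorics: a one-anchor count from a five-anchor count, any alphabet), `card_sectorLeg_sectorCount`;
* §2 the named witnesses `klThinCount6C`, `klThinCount6C₃ R`, `klThinCount6U₀ R` (closed terms, pattern of …EngineThinCountDoors) and
  **`card_bgmSectorSet_klAniso_six_anchored_le_doors`** — `#{Ω ∈ bgmSectorSet … 6 : Ω p = s} ≤ klThinCount6C·|SectorLeg (sectorCount n)|⁴`;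
* §3 `klLevUnitF_zero_three_eq`, **`klLevNormOf_six_le_card_mul`**, **`klTowerMeasLev_six_le_count_mul`**, and the import
  **`klTowerMuLevAtF_zero_three_le_floor_import_doors`**: `klTowerMuLevAtF L M β U μ K d 0 k 3 ≤ 110592·klThinCount6C·B₆/ε⁵` under the doors and an all-fixed
  anisotropic six-leg pinned line `B₆` of the block input (E1's six-leg line; a hypothesis here).
Definitions with bodies + order lemmas + consumer theorems; nothing about the model is asserted beyond the landed counts; nothing asserts (ℓ), any stub, K3 or
superconductivity.  References: BGM 2006 §2.7 (2.71a), §2.8 (2.73), (2.76)–(2.80), (2.96)–(2.98), Lemma 2.5 [cite: BenfattoGiulianiMastropietro2006].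
-/

noncomputable section

namespace Summit.HubbardSuperconductivity.HubbardSuperconductivity.Theorems.KLRegimeSplit

set_option linter.dupNamespace false -- summit = problem name (single-conjunct summit), D-0017

open Real Finset Literature.MathematicalPhysics.QuantumLattice Literature.Probability.LatticeModels
open Summit.HubbardSuperconductivity.HubbardSuperconductivity.Theorems.KLProgrammeLegKernels
open Summit.HubbardSuperconductivity.HubbardSuperconductivity.Theorems.DispersionFlow
open Summit.HubbardSuperconductivity.HubbardSuperconductivity.Theorems.PerturbedFermiCurve

/-! ## §1 A one-anchor count from a five-anchor count -/

/-- **One anchor from five anchors**: if every five-anchored count of a set `A` of six-leg label tuples over an alphabet `S` is `≤ C`, then every one-anchored count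
is `≤ C·|S|⁴` — sum over the labels of four further legs. [folklore] -/
theorem card_filter_eq_le_of_fiveAnchored {S : Type*} [Fintype S] [DecidableEq S] (A : Finset (Fin 6 → S)) {C : ℝ}
    (h5 : ∀ (E : Finset (Fin 6)), 5 ≤ E.card → ∀ τ : Fin 6 → S, (((A.filter (fun Ω : Fin 6 → S => ∀ e ∈ E, Ω e = τ e)).card : ℕ) : ℝ) ≤ C)
    (p : Fin 6) (s : S) :
    (((A.filter (fun Ω : Fin 6 → S => Ω p = s)).card : ℕ) : ℝ) ≤ C * (Fintype.card S : ℝ) ^ 4 := by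
  classical
  set σ : Equiv.Perm (Fin 6) := Equiv.swap 0 p with hσ
  have hσ0 : σ 0 = p := by rw [hσ]; exact Equiv.swap_apply_left 0 p
  set T := A.filter (fun Ω : Fin 6 → S => Ω p = s) with hT
  set g : (Fin 6 → S) → S × S × S × S := fun Ω => (Ω (σ 1), Ω (σ 2), Ω (σ 3), Ω (σ 4)) with hg
  -- the anchored legs `σ 0, …, σ 4`
  set E : Finset (Fin 6) := (Finset.univ : Finset (Fin 5)).image (fun i => σ (Fin.castSucc i)) with hE
  have hinj : Function.Injective (fun i : Fin 5 => σ (Fin.castSucc i)) := fun a b h => Fin.castSucc_injective 5 (σ.injective h)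
  have hEcard : 5 ≤ E.card := by
    rw [hE, Finset.card_image_of_injective _ hinj]
    simp
  -- each fibre of `g` on `T` is a five-anchored set
  have hfib : ∀ b : S × S × S × S, (((T.filter (fun Ω => g Ω = b)).card : ℕ) : ℝ) ≤ C := by
    intro b
    set vec : Fin 6 → S := ![s, b.1, b.2.1, b.2.2.1, b.2.2.2, s] with hvec
    refine le_trans ?_ (h5 E hEcard (fun e => vec (σ.symm e)))
    exact_mod_cast Finset.card_le_card fun Ω hΩ => by
      rw [Finset.mem_filter] at hΩ
      obtain ⟨hΩT, hgb⟩ := hΩ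
      rw [hT, Finset.mem_filter] at hΩT
      refine Finset.mem_filter.2 ⟨hΩT.1, fun e he => ?_⟩
      rw [hE, Finset.mem_image] at he
      obtain ⟨i, -, rfl⟩ := he
      rw [Equiv.symm_apply_apply]
      subst hgb
      match i with
      | 0 => simpa [hvec, hσ0] using hΩT.2
      | 1 => simp [hvec, hg]
      | 2 => simp [hvec, hg]
      | 3 => simp [hvec, hg]
      | 4 => simp [hvec, hg]
  have hsum := Finset.card_eq_sum_card_fiberwise (f := g) (s := T) (t := (Finset.univ : Finset (S × S × S × S))) (fun _ _ => Finset.mem_univ _)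
  calc ((T.card : ℕ) : ℝ) = ∑ b : S × S × S × S, (((T.filter (fun Ω => g Ω = b)).card : ℕ) : ℝ) := by rw [hsum]; push_cast; rfl
    _ ≤ ∑ _b : S × S × S × S, C := Finset.sum_le_sum fun b _ => hfib b
    _ = C * (Fintype.card S : ℝ) ^ 4 := by
        rw [Finset.sum_const, Finset.card_univ, nsmul_eq_mul, Fintype.card_prod, Fintype.card_prod, Fintype.card_prod]
        push_cast; ring

/-- `|SectorLeg (sectorCount n)| = 8·2ⁿ` (sectors `2^{n+1}` × spin × charge). [folklore] -/
theorem card_sectorLeg_sectorCount (n : ℕ) : (Fintype.card (SectorLeg (sectorCount n)) : ℝ) = 8 * (2 : ℝ) ^ n := by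
  simp [SectorLeg, Fintype.card_prod, Fintype.card_fin, sectorCount, pow_succ]
  ring

/-! ## §2 The named witnesses and the one-anchor six-leg count under the doors -/

open Classical in
/-- **`klThinCount6C`** — the geometric constant of the five-anchored six-leg anisotropic sector count on `klWindowC` (the classical witness `C` of
`card_bgmSectorSet_klAniso_fiveAnchored_le_window`; independent of `R`, `β`, `U`, `c`, `L`, `M`, the scale, the anchored legs and their labels). -/
def klThinCount6C : ℝ := Classical.choose card_bgmSectorSet_klAniso_fiveAnchored_le_window

/-- `0 < klThinCount6C`. -/
theorem klThinCount6C_pos : 0 < klThinCount6C := (Classical.choose_spec card_bgmSectorSet_klAniso_fiveAnchored_le_window).1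

/-- The defining property of `klThinCount6C`. -/
theorem klThinCount6C_spec : ∀ R : RenConsts, (∀ j, 0 ≤ R.Gfr j) →
    ∃ c₃ : ℝ, 0 < c₃ ∧ ∃ U₀ : ℝ, 0 < U₀ ∧
      ∀ c : ℝ, 0 < c → c ≤ c₃ → ∀ U : ℝ, 0 < U → U ≤ U₀ → ∀ β : ℝ, klBetaMin ≤ β → β ≤ Real.exp (c / U ^ 2) →
      ∀ μ ∈ klWindowC, ∀ (ν : ℝ) (K : TrigPolyC4v), FrameOK R U (nScales β) ν K →
      ∀ (L M : ℕ) [NeZero L] (n : ℕ) (E : Finset (Fin 6)), 5 ≤ E.card → ∀ τ : Fin 6 → SectorLeg (sectorCount n),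
      ((((bgmSectorSet L M (klAnisoFamily L M β μ K klE0 n) 6).filter
          (fun Ω : Fin 6 → SectorLeg (sectorCount n) => ∀ e ∈ E, Ω e = τ e)).card : ℕ) : ℝ) ≤ klThinCount6C :=
  (Classical.choose_spec card_bgmSectorSet_klAniso_fiveAnchored_le_window).2

open Classical in
/-- **`klThinCount6C₃ R`** — the coupling-temperature door of the six-leg count (classical witness; `1` off the admissible set). -/
def klThinCount6C₃ (R : RenConsts) : ℝ :=
  if h : (∀ j, 0 ≤ R.Gfr j) then Classical.choose (klThinCount6C_spec R h) else 1

open Classical in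
/-- **`klThinCount6U₀ R`** — the coupling door of the six-leg count (classical witness; `1` off the admissible set). -/
def klThinCount6U₀ (R : RenConsts) : ℝ :=
  if h : (∀ j, 0 ≤ R.Gfr j) then Classical.choose (Classical.choose_spec (klThinCount6C_spec R h)).2 else 1

/-- `0 < klThinCount6C₃ R`. -/
theorem klThinCount6C₃_pos (R : RenConsts) : 0 < klThinCount6C₃ R := by
  classical
  unfold klThinCount6C₃
  split_ifs with h
  · exact (Classical.choose_spec (klThinCount6C_spec R h)).1
  · exact one_pos

/-- `0 < klThinCount6U₀ R`. -/
theorem klThinCount6U₀_pos (R : RenConsts) : 0 < klThinCount6U₀ R := by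
  classical
  unfold klThinCount6U₀
  split_ifs with h
  · exact (Classical.choose_spec (Classical.choose_spec (klThinCount6C_spec R h)).2).1
  · exact one_pos

/-- **THE ONE-ANCHOR SIX-LEG ANISOTROPIC SECTOR COUNT UNDER THE NAMED DOORS**: for `R` with `0 ≤ R.Gfr j`, `0 < c ≤ klThinCount6C₃ R`, `0 < U ≤ klThinCount6U₀ R`,
`klBetaMin ≤ β ≤ e^{c/U²}`, `μ ∈ klWindowC`, every frame with `FrameOK R U (nScales β) ν K`, every `L ≥ 1`, `M`, scale `n`, anchor leg `p` and label `s`: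
`#{Ω ∈ bgmSectorSet L M (klAnisoFamily L M β μ K klE0 n) 6 : Ω p = s} ≤ klThinCount6C · |SectorLeg (sectorCount n)|⁴` (`= klThinCount6C·4096·2^{4n}`).
[cite: BenfattoGiulianiMastropietro2006, §2.8 (2.73), (2.76)–(2.80), (2.96)–(2.98), Lemma 2.5, App. A3] -/
theorem card_bgmSectorSet_klAniso_six_anchored_le_doors {R : RenConsts} (hR : ∀ j, 0 ≤ R.Gfr j) {c : ℝ} (hc : 0 < c)
    (hc₃ : c ≤ klThinCount6C₃ R) {U : ℝ} (hU : 0 < U) (hU₀ : U ≤ klThinCount6U₀ R) {β : ℝ} (hβ : klBetaMin ≤ β)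
    (hβc : β ≤ Real.exp (c / U ^ 2)) {μ : ℝ} (hμ : μ ∈ klWindowC) (ν : ℝ) {K : TrigPolyC4v} (hK : FrameOK R U (nScales β) ν K)
    (L M : ℕ) [NeZero L] (n : ℕ) (p : Fin 6) (s : SectorLeg (sectorCount n)) :
    ((((bgmSectorSet L M (klAnisoFamily L M β μ K klE0 n) 6).filter
        (fun Ω : Fin 6 → SectorLeg (sectorCount n) => Ω p = s)).card : ℕ) : ℝ) ≤
      klThinCount6C * (Fintype.card (SectorLeg (sectorCount n)) : ℝ) ^ 4 := by
  classical
  have h3 : klThinCount6C₃ R = Classical.choose (klThinCount6C_spec R hR) := by unfold klThinCount6C₃; exact dif_pos hR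
  have hU' : klThinCount6U₀ R = Classical.choose (Classical.choose_spec (klThinCount6C_spec R hR)).2 := by
    unfold klThinCount6U₀; exact dif_pos hR
  have hspec := (Classical.choose_spec (Classical.choose_spec (klThinCount6C_spec R hR)).2).2
  rw [h3] at hc₃
  rw [hU'] at hU₀
  exact card_filter_eq_le_of_fiveAnchored _ (fun E hE τ => hspec c hc hc₃ U hU hU₀ β hβ hβc μ hμ ν K hK L M n E hE τ) p s

end Summit.HubbardSuperconductivity.HubbardSuperconductivity.Theorems.KLRegimeSplit

/-! ## §3 The six-leg one-level floor import -/

namespace Summit.HubbardSuperconductivity.HubbardSuperconductivity.Theorems.EngineV8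

set_option linter.dupNamespace false -- summit = problem name (single-conjunct summit), D-0017

open Classical
open Real Finset Literature.MathematicalPhysics.QuantumLattice Literature.Probability.LatticeModels
open Literature.MathematicalPhysics.QuantumLattice.FermiRG
open Summit.HubbardSuperconductivity.HubbardSuperconductivity.Theorems.KLRegimeSplit
open Summit.HubbardSuperconductivity.HubbardSuperconductivity.Theorems.KLProgrammeLegKernels
open Summit.HubbardSuperconductivity.HubbardSuperconductivity.Theorems.DispersionFlow

variable {L M : ℕ} [NeZero L]

omit [NeZero L] in
/-- **The six-leg floor unit at track `0`**: `klLevUnitF β M 0 3 J = ε⁵·2^{4J}`. -/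
theorem klLevUnitF_zero_three_eq (β : ℝ) (M : ℕ) (J : ℕ) : klLevUnitF β M 0 3 J = imagTimeWeight β M ^ 5 * (2 : ℝ) ^ (4 * J) := by
  unfold klLevUnitF
  have hg : klLevGain (0 : Fin 5) * J = 0 := by rw [show klLevGain (0 : Fin 5) = 0 from rfl, zero_mul]
  have h8 : (8 : ℝ) ^ (J * 3) = (2 : ℝ) ^ (5 * J) * (2 : ℝ) ^ (4 * J) := by
    rw [show (8 : ℝ) = 2 ^ 3 by norm_num, ← pow_mul, ← pow_add]; congr 1; ring
  rw [show 2 * 3 - 1 = 5 from rfl, h8, hg, pow_zero, mul_one]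
  have h5 : (2 : ℝ) ^ (5 * J) ≠ 0 := pow_ne_zero _ two_ne_zero
  field_simp

/-- **ONE-PRESCRIBED SIX-LEG SIZE ≤ ONE-ANCHOR COUNT × ALL-FIXED SIZE** (any `T`, family `J`, prescription `Ωe`): if every one-anchored count of compatible
anisotropic 6-tuples is `≤ N_c` and every compatible tuple's pinned `L¹` size `ε⁵·Σ_{X : X p = x} ‖W^{F_J}_{6,Ω}(T)(X)‖` is `≤ B₆`, then
`klLevNormOf L M β μ K J 6 T Ωe ≤ N_c · B₆`. [cite: BenfattoGiulianiMastropietro2006, §2.8 (2.76)-(2.77) and (2.96)] -/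
theorem klLevNormOf_six_le_card_mul {β : ℝ} (hβ : 0 ≤ β) (μ : ℝ) (K : TrigPolyC4v) (J : ℕ) (T : HubbardGrassmann L M)
    (Ωe : Fin 6 → Option (SectorLeg (sectorCount J))) {Nc B₆ : ℝ} (hNc : 0 ≤ Nc) (hB : 0 ≤ B₆)
    (hcount : ∀ (p : Fin 6) (s : SectorLeg (sectorCount J)),
      ((((bgmSectorSet L M (klAnisoFamily L M β μ K klE0 J) 6).filter
        (fun Ω : Fin 6 → SectorLeg (sectorCount J) => Ω p = s)).card : ℕ) : ℝ) ≤ Nc)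
    (hline : ∀ Ω ∈ bgmSectorSet L M (klAnisoFamily L M β μ K klE0 J) 6, ∀ (p : Fin 6) (x : SpaceTimeIdx L M),
      imagTimeWeight β M ^ 5 * ∑ X ∈ univ.filter (fun X : Fin 6 → SpaceTimeIdx L M => X p = x),
        ‖sectorisedKernel L M β (klAnisoFamily L M β μ K klE0 J) T 6 Ω X‖ ≤ B₆) :
    klLevNormOf L M β μ K J 6 T Ωe ≤ Nc * B₆ := by
  unfold klLevNormOf
  rw [hubbardSectorKernelNorm_def]
  refine (sectorisedKernelNorm_mono_set (imagTimeWeight_nonneg hβ M) (prescribedTuples_subset _ _) _).trans ?_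
  exact sectorisedKernelNorm_le_card_mul (imagTimeWeight β M) (m := 5) _ _ hNc hB hcount hline

/-- **THE MEASURED LEVELLED SIX-LEG SIZE OF BLOCK `k` FROM A ONE-ANCHOR COUNT** (input `𝒱_{dk}` at `F_{dk−1}`, every level `F`): `klTowerMeasLev … d k 6 F ≤ N_c·B₆`.
[cite: BenfattoGiulianiMastropietro2006, §2.8 (2.76)-(2.77), (2.96)] -/
theorem klTowerMeasLev_six_le_count_mul [NeZero M] {β : ℝ} (hβ : 0 ≤ β) (U μ : ℝ) (K : TrigPolyC4v) (d k F : ℕ) {Nc B₆ : ℝ} (hNc : 0 ≤ Nc) (hB : 0 ≤ B₆)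
    (hcount : ∀ (p : Fin 6) (s : SectorLeg (sectorCount (d * k - 1))),
      ((((bgmSectorSet L M (klAnisoFamily L M β μ K klE0 (d * k - 1)) 6).filter
        (fun Ω : Fin 6 → SectorLeg (sectorCount (d * k - 1)) => Ω p = s)).card : ℕ) : ℝ) ≤ Nc)
    (hline : ∀ Ω ∈ bgmSectorSet L M (klAnisoFamily L M β μ K klE0 (d * k - 1)) 6, ∀ (p : Fin 6) (x : SpaceTimeIdx L M),
      imagTimeWeight β M ^ 5 * ∑ X ∈ univ.filter (fun X : Fin 6 → SpaceTimeIdx L M => X p = x),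
        ‖sectorisedKernel L M β (klAnisoFamily L M β μ K klE0 (d * k - 1)) (klTowerInput L M β U μ K d k) 6 Ω X‖ ≤ B₆) :
    klTowerMeasLev L M β U μ K d k 6 F ≤ Nc * B₆ := by
  unfold klTowerMeasLev
  refine Real.iSup_le (fun Ωe => ?_) (mul_nonneg hNc hB)
  exact klLevNormOf_six_le_card_mul hβ μ K (d * k - 1) _ Ωe.1 hNc hB hcount hline

/-- **THE SIX-LEG ONE-LEVEL FLOOR IMPORT UNDER THE NAMED DOORS** («(ℓ)-IMPORT-X-FLOOR» cured modulo the all-fixed six-leg line `B₆`): for `R` with `0 ≤ R.Gfr j`,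
`0 < c ≤ klThinCount6C₃ R`, `0 < U ≤ klThinCount6U₀ R`, `klBetaMin ≤ β ≤ e^{c/U²}`, `μ ∈ klWindowC`, a frame with `FrameOK R U (nScales β) ν K`, `1 ≤ dk`, and an
all-fixed anisotropic six-leg pinned line `B₆ ≥ 0` of the block input `𝒱_{dk}` sectorised with `F_{dk−1}`:
**`klTowerMuLevAtF L M β U μ K d 0 k 3 ≤ 110592·klThinCount6C·B₆/ε⁵`** — the count's `|SectorLeg|⁴ = 4096·2^{4J}` against the unit `ε⁵·2^{4J}`: k-UNIFORM.
[cite: BenfattoGiulianiMastropietro2006, §2.7 (2.71a), §2.8 (2.96)-(2.98), Lemma 2.5] -/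
theorem klTowerMuLevAtF_zero_three_le_floor_import_doors [NeZero M] {R : RenConsts} (hR : ∀ j, 0 ≤ R.Gfr j) {c : ℝ} (hc : 0 < c)
    (hc₃ : c ≤ klThinCount6C₃ R) {U : ℝ} (hU : 0 < U) (hU₀ : U ≤ klThinCount6U₀ R) {β : ℝ} (hβ : klBetaMin ≤ β) (hβc : β ≤ Real.exp (c / U ^ 2))
    {μ : ℝ} (hμ : μ ∈ klWindowC) (ν : ℝ) {K : TrigPolyC4v} (hK : FrameOK R U (nScales β) ν K) (d k : ℕ) {B₆ : ℝ} (hB : 0 ≤ B₆)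
    (hline : ∀ Ω ∈ bgmSectorSet L M (klAnisoFamily L M β μ K klE0 (d * k - 1)) 6, ∀ (p : Fin 6) (x : SpaceTimeIdx L M),
      imagTimeWeight β M ^ 5 * ∑ X ∈ univ.filter (fun X : Fin 6 → SpaceTimeIdx L M => X p = x),
        ‖sectorisedKernel L M β (klAnisoFamily L M β μ K klE0 (d * k - 1)) (klTowerInput L M β U μ K d k) 6 Ω X‖ ≤ B₆) :
    klTowerMuLevAtF L M β U μ K d 0 k 3 ≤ 110592 * klThinCount6C * B₆ / imagTimeWeight β M ^ 5 := by
  have hβ0 : 0 < β := KLRegimeSplit.pos_of_klBetaMin_le hβ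
  have hε : 0 < imagTimeWeight β M := imagTimeWeight_pos_of_pos (M := M) hβ0
  have hC : 0 ≤ klThinCount6C := klThinCount6C_pos.le
  set J := d * k - 1 with hJ
  have hcard : (Fintype.card (SectorLeg (sectorCount J)) : ℝ) ^ 4 = 4096 * (2 : ℝ) ^ (4 * J) := by
    rw [card_sectorLeg_sectorCount, mul_pow, ← pow_mul, mul_comm J 4]; norm_num
  have hNc : 0 ≤ klThinCount6C * (Fintype.card (SectorLeg (sectorCount J)) : ℝ) ^ 4 := by positivity
  have hM : klTowerMeasLev L M β U μ K d k 6 1 ≤ klThinCount6C * (Fintype.card (SectorLeg (sectorCount J)) : ℝ) ^ 4 * B₆ :=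
    klTowerMeasLev_six_le_count_mul hβ0.le U μ K d k 1 hNc hB
      (fun p s => card_bgmSectorSet_klAniso_six_anchored_le_doors hR hc hc₃ hU hU₀ hβ hβc hμ ν hK L M J p s) hline
  rw [hcard] at hM
  have hU0 : 0 < klLevUnitF β M 0 3 J := klLevUnitF_pos hβ0 0 3 J
  unfold klTowerMuLevAtF
  rw [show 2 * 3 = 6 from rfl, show ((0 : Fin 5) : ℕ) + 1 = 1 from rfl, ← hJ, div_le_iff₀ hU0, klLevUnitF_zero_three_eq, pow_one]
  have h2J : (0 : ℝ) < (2 : ℝ) ^ (4 * J) := by positivity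
  calc (27 : ℝ) * klTowerMeasLev L M β U μ K d k 6 1 ≤ 27 * (klThinCount6C * (4096 * (2 : ℝ) ^ (4 * J)) * B₆) := by gcongr
    _ = 110592 * klThinCount6C * B₆ / imagTimeWeight β M ^ 5 * (imagTimeWeight β M ^ 5 * (2 : ℝ) ^ (4 * J)) := by field_simp; ring

end Summit.HubbardSuperconductivity.HubbardSuperconductivity.Theorems.EngineV8

end
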